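import Mathlib
import HarnessLib

/-!
# Route `AxisTwistDoor`, crux `AveragedConeLiouville` (stmt-NavierStokesRegularity-26889), line `lrt_shell` —
# discharging `PositivityPropagationFactC` WITHOUT Nazarov–Ural'tseva, brick P4: A DENSE SMALL BALL BY PIGEONHOLE

Pure measure theory in `ℝ³`: a measurable set `E ⊆ B(0, ρ)` meets some closed ball of radius `h` — centred at a
point of the grid `(h/2)ℤ³` within distance `ρ + h` of the origin — in measure at least `vol E / (4ρ/h + 5)³`
(`exists_dense_ball`).  Indeed the closed `h`-balls about the `≤ (4ρ/h + 5)³` grid points cover `B(0, ρ)` (round each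
coordinate to the nearest multiple of `h/2`), so the largest of the measures `vol (E ∩ B̄(q, h))` is at least the
average.  This converts the MEASURE hypothesis `|{V(t̄, ·) ≥ λ}| ≥ δ` of the positivity propagation into a ball on
which that set has density `≳ δ`, the input of brick P3.

Seat ns-atd-p1 (LEAD g2).  WHAT THIS IS NOT: not a statement about Navier–Stokes regularity; a covering lemma
serving a STAGED door route.  Lands `--supports` the crux item as a helper.
-/

noncomputable section

-- the summit and its single sub-problem share the name (CONVENTIONS §1), as in every Theorems file
set_option linter.dupNamespace false

namespace Summit.NavierStokesRegularity.NavierStokesRegularity.Theorems.AveragedConeLiouville.PositivityCover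

open scoped ENNReal Topology NNReal RealInnerProductSpace
open Set Function MeasureTheory Metric Filter Real

/-- A coordinate is bounded by the Euclidean norm: `|x i| ≤ ‖x‖`. -/
theorem abs_apply_le_norm (x : EuclideanSpace ℝ (Fin 3)) (i : Fin 3) : |x i| ≤ ‖x‖ := by
  rw [EuclideanSpace.norm_eq, ← Real.sqrt_sq_eq_abs]
  refine Real.sqrt_le_sqrt ?_
  have : ‖x i‖ ^ 2 ≤ ∑ j, ‖x j‖ ^ 2 :=
    Finset.single_le_sum (f := fun j => ‖x j‖ ^ 2) (fun j _ => sq_nonneg _) (Finset.mem_univ i)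
  simpa [Real.norm_eq_abs, sq_abs] using this

/-- Rounding the coordinates to the grid `aℤ³` moves a point by at most `a` (indeed `a√3/2`):
`dist x (a·round(x/a)) ≤ a`. -/
theorem dist_round_le (x : EuclideanSpace ℝ (Fin 3)) {a : ℝ} (ha : 0 < a) :
    dist x (WithLp.toLp 2 fun i => a * (round (x i / a) : ℝ) : EuclideanSpace ℝ (Fin 3)) ≤ a := by
  have hcoord : ∀ i, dist (x i) (a * (round (x i / a) : ℝ)) ≤ a / 2 := by
    intro i
    have h1 := abs_sub_round (x i / a)
    rw [Real.dist_eq]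
    have h2 : x i - a * (round (x i / a) : ℝ) = a * (x i / a - round (x i / a)) := by
      rw [mul_sub, mul_div_cancel₀ _ ha.ne']
    rw [h2, abs_mul, abs_of_pos ha]
    nlinarith
  rw [EuclideanSpace.dist_eq]
  have hsum : ∑ i : Fin 3, dist (x i) ((WithLp.toLp 2 fun i => a * (round (x i / a) : ℝ) :
      EuclideanSpace ℝ (Fin 3)) i) ^ 2 ≤ a ^ 2 := by
    have h3 : ∀ i : Fin 3, dist (x i) ((WithLp.toLp 2 fun i => a * (round (x i / a) : ℝ) :
        EuclideanSpace ℝ (Fin 3)) i) ^ 2 ≤ (a / 2) ^ 2 := by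
      intro i
      have := hcoord i
      rw [PiLp.toLp_apply]
      exact pow_le_pow_left₀ dist_nonneg this 2
    calc ∑ i : Fin 3, _ ≤ ∑ _i : Fin 3, (a / 2) ^ 2 := Finset.sum_le_sum fun i _ => h3 i
      _ = 3 * (a / 2) ^ 2 := by simp
      _ ≤ a ^ 2 := by nlinarith
  calc Real.sqrt _ ≤ Real.sqrt (a ^ 2) := Real.sqrt_le_sqrt hsum
    _ = a := Real.sqrt_sq ha.le

/-- **A dense small ball by pigeonhole.**  For `E ⊆ B(0, ρ) ⊂ ℝ³` and `h > 0` there is a point `q` with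
`‖q‖ ≤ ρ + h` and `vol E ≤ (4ρ/h + 5)³ · vol (E ∩ B̄(q, h))`. -/
theorem exists_dense_ball {E : Set (EuclideanSpace ℝ (Fin 3))} {ρ h : ℝ} (hρ : 0 < ρ) (hh : 0 < h)
    (hEsub : E ⊆ ball 0 ρ) :
    ∃ q : EuclideanSpace ℝ (Fin 3), ‖q‖ ≤ ρ + h ∧
      volume E ≤ ENNReal.ofReal ((4 * ρ / h + 5) ^ 3) * volume (E ∩ closedBall q h) := by
  set a : ℝ := h / 2 with ha'
  have ha : 0 < a := by positivity
  set M : ℕ := ⌈ρ / a⌉₊ + 1 with hM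
  set box : Finset (Fin 3 → ℤ) := Fintype.piFinset fun _ => Finset.Icc (-(M : ℤ)) M with hbox
  set p : (Fin 3 → ℤ) → EuclideanSpace ℝ (Fin 3) := fun k => WithLp.toLp 2 fun i => a * (k i : ℝ) with hp
  set S : Finset (Fin 3 → ℤ) := box.filter (fun k => ‖p k‖ ≤ ρ + h) with hS
  -- every point of `B(0, ρ)` is within `h` of a grid point of `S`
  have hround : ∀ x ∈ ball (0 : EuclideanSpace ℝ (Fin 3)) ρ, ∃ k ∈ S, x ∈ closedBall (p k) h := by
    intro x hx
    have hxn : ‖x‖ < ρ := by simpa using hx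
    set k : Fin 3 → ℤ := fun i => round (x i / a) with hk
    have hdist : dist x (p k) ≤ h := by
      have := dist_round_le x ha
      have hle : a ≤ h := by rw [ha']; linarith
      exact le_trans this hle
    refine ⟨k, ?_, mem_closedBall.2 hdist⟩
    rw [hS, Finset.mem_filter]
    refine ⟨?_, ?_⟩
    · -- the rounded coordinates lie in the box `[-M, M]³`
      rw [hbox, Fintype.mem_piFinset]
      intro i
      rw [Finset.mem_Icc, ← abs_le]
      have h1 : |(k i : ℝ)| ≤ |x i / a| + 1 / 2 := by
        have := abs_sub_round (x i / a)
        have h4 : |(round (x i / a) : ℝ)| ≤ |x i / a| + |x i / a - round (x i / a)| := by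
          have := abs_sub_abs_le_abs_sub (round (x i / a) : ℝ) (x i / a)
          rw [abs_sub_comm] at this
          linarith
        simpa [hk] using h4.trans (by linarith)
      have h2 : |x i / a| ≤ ρ / a := by
        rw [abs_div, abs_of_pos ha]
        exact div_le_div_of_nonneg_right ((abs_apply_le_norm x i).trans hxn.le) ha.le
      have h3 : ρ / a ≤ ⌈ρ / a⌉₊ := Nat.le_ceil _
      have h5 : |(k i : ℝ)| ≤ (M : ℝ) := by
        rw [hM]; push_cast; linarith
      have h6 : ((|k i| : ℤ) : ℝ) ≤ ((M : ℤ) : ℝ) := by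
        rw [Int.cast_abs]; exact_mod_cast h5
      exact_mod_cast h6
    · -- and the grid point is within `ρ + h` of the origin
      calc ‖p k‖ = dist (p k) 0 := (dist_zero_right _).symm
        _ ≤ dist (p k) x + dist x 0 := dist_triangle _ _ _
        _ ≤ h + ρ := add_le_add (by rw [dist_comm]; exact hdist) (by simpa using hxn.le)
        _ = ρ + h := add_comm _ _
  -- hence `E` is covered by the traces of the balls
  have hcover : E ⊆ ⋃ k ∈ S, (E ∩ closedBall (p k) h) := by
    intro x hx
    obtain ⟨k, hk, hxk⟩ := hround x (hEsub hx)
    exact mem_biUnion hk ⟨hx, hxk⟩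
  have hsum : volume E ≤ ∑ k ∈ S, volume (E ∩ closedBall (p k) h) :=
    (measure_mono hcover).trans (measure_biUnion_finset_le S _)
  -- the number of grid points
  have hcard : (S.card : ℝ) ≤ (4 * ρ / h + 5) ^ 3 := by
    have h1 : S.card ≤ box.card := Finset.card_filter_le _ _
    have h2 : box.card = (2 * M + 1) ^ 3 := by
      rw [hbox, Fintype.card_piFinset, Finset.prod_const, Finset.card_univ, Fintype.card_fin, Int.card_Icc]
      congr 1
      have : (M : ℤ) + 1 - -(M : ℤ) = ((2 * M + 1 : ℕ) : ℤ) := by push_cast; ring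
      rw [this, Int.toNat_natCast]
    have h3 : (M : ℝ) ≤ ρ / a + 2 := by
      rw [hM]; push_cast
      have := Nat.ceil_lt_add_one (div_nonneg hρ.le ha.le)
      linarith
    have h4 : ((2 * M + 1 : ℕ) : ℝ) ≤ 4 * ρ / h + 5 := by
      push_cast
      have : ρ / a = 2 * ρ / h := by rw [ha']; field_simp
      rw [this] at h3
      have : 2 * (2 * ρ / h) = 4 * ρ / h := by ring
      linarith
    calc (S.card : ℝ) ≤ (box.card : ℝ) := by exact_mod_cast h1
      _ = ((2 * M + 1 : ℕ) : ℝ) ^ 3 := by rw [h2]; push_cast; ring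
      _ ≤ (4 * ρ / h + 5) ^ 3 := pow_le_pow_left₀ (by positivity) h4 3
  -- pigeonhole
  by_cases hSne : S.Nonempty
  · obtain ⟨k, hk, hmax⟩ := S.exists_max_image (fun k => volume (E ∩ closedBall (p k) h)) hSne
    refine ⟨p k, (Finset.mem_filter.1 hk).2, ?_⟩
    calc volume E ≤ ∑ j ∈ S, volume (E ∩ closedBall (p j) h) := hsum
      _ ≤ S.card • volume (E ∩ closedBall (p k) h) := Finset.sum_le_card_nsmul _ _ _ fun j hj => hmax j hj
      _ = (S.card : ℝ≥0∞) * volume (E ∩ closedBall (p k) h) := by rw [nsmul_eq_mul]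
      _ ≤ ENNReal.ofReal ((4 * ρ / h + 5) ^ 3) * volume (E ∩ closedBall (p k) h) := by
        gcongr
        have : (S.card : ℝ≥0∞) = ENNReal.ofReal (S.card : ℝ) := by rw [ENNReal.ofReal_natCast]
        rw [this]
        exact ENNReal.ofReal_le_ofReal hcard
  · -- no grid point: then `E` is empty
    have hE : E = ∅ := by
      rw [Finset.not_nonempty_iff_eq_empty] at hSne
      rw [hSne] at hcover
      simpa using hcover
    refine ⟨0, by simp; linarith, ?_⟩
    rw [hE]; simp

end Summit.NavierStokesRegularity.NavierStokesRegularity.Theorems.AveragedConeLiouville.PositivityCover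

end
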